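import Literature.Probability.LatticeModels.DirichletGreenFunction
import Literature.Probability.LatticeModels.LatticeLaplacian
import Literature.Probability.LatticeModels.WeakBeurlingEstimate
import Summits.CriticalPhenomena.CardyFormulaZ2.Theorems.CardyBoundaryCoulombGasBoundaryDefectGaussianRStubGreenKernelAsymptoticsPart1

/-!
# Stub `stub_clusterLocalityV2` of line `rainbow-monomials-in-excursion-kernels` — Part 1:
# half-rectangles standing on a row, the quadratic side barrier, and the harmonic measure of
# the far sides (crux `BoundaryDefectGaussianR`, stmt-CriticalPhenomena-14132)

The Green half (G1) of cluster locality: for two finite domains `V, V' ⊆ ℤ²` which are flat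
(`= {v₁ ≥ a₁}`) in a ball of radius `M·m` about anchors `a, a'`, and points `x, y` on the anchor
row within `m` of the anchor, `|log G_V(x,y) - log G_{V'}(x',y')| ≤ C/M²` for the tree's
Dirichlet Green function `G = dirichletGreen` (`DirichletGreenFunction.lean`). This first file
sets up the planar bookkeeping. Rectangles are handled SPECIFICATION-STYLE (no new definitions):
a finite set `Q` together with the hypothesis
`∀ v, v ∈ Q ↔ (y₀ - n ≤ v₀ ≤ y₀ + n) ∧ (y₁ ≤ v₁ ≤ y₁ + T)` is "the half-rectangle of half-width
`n` and height `T` standing on the row of `y`" (`T = n`: the half-box).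

* `latticeLaplacian_eq_latticeLaplacianZd` — the two lattice Laplacians of the tree on `Site 2`
  (`LatticeLaplacian.lean`, `cornerUnit`; `LatticeLaplacianZd.lean`, `Pi.single`) agree;
* `outerBoundary_halfRect` — the outer boundary of a half-rectangle: bottom row, top row, two
  sides;
* the harmonic quadratic **side barrier**
  `q(v) = (Y+1)/(n+2) + (X² + (Y+1)(n+1-Y))/(n+1)²`, `X = v₀ - y₀`, `Y = v₁ - y₁`
  (hypothesis `hq : ∀ v, q v = …`): `Δq = 0`, `q ≥ 0` on the slab `-1 ≤ Y ≤ n+1`, `q ≥ 1` on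
  the top row and the two sides of the half-box, `q(y) ≤ 2/(n+1)`, and `q ≤ 1/2` on the
  half-box of size `k` when `8k ≤ n`;
* **(A) harmonic measure of the far sides seen from the centre of the bottom row**:
  `∑_{z ∈ ∂Q, z₁ ≥ y₁} H_Q(y, z) ≤ q(y) ≤ 2/(n+1)` by Green's representation formula
  (`green_representation`) for the harmonic `q` — the gambler's-ruin order `1/n` of the escape
  probability of the walk started next to the absorbing row
  (`sum_poissonKernel_far_le`, registered sub-goal `s10_farSidesHarmonicMeasure`), and more
  generally `∑_{far} H_{Q ∖ {p}}(w, ·) ≤ q(w)` from any point `w` (`sum_poissonKernel_far_le_of`),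
  the form used by the two-scale decay argument of Part 3.

All statements are folklore lattice potential theory (Lawler 1991 §1.4–1.5; Lawler–Limic 2010
§6.2, §8.1).
-/

noncomputable section

namespace Summit.CriticalPhenomena.CardyFormulaZ2.Cruxes.BoundaryDefectGaussianR.RainbowMonomialsInExcursionKernels

open Finset Literature.Probability.LatticeModels

/-! ### The two lattice Laplacians on `ℤ²` agree; coordinates -/

/-- The four-neighbour Laplacian `latticeLaplacian` of `LatticeLaplacian.lean` (steps
`cornerUnit k`) is the `d = 2` case of `latticeLaplacianZd` (steps `± Pi.single i 1`).
[folklore] -/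
theorem latticeLaplacian_eq_latticeLaplacianZd (H : Site 2 → ℝ) (v : Site 2) :
    latticeLaplacian H v = latticeLaplacianZd H v := by
  rw [latticeLaplacian, Fin.sum_univ_four, latticeLaplacianZd_def, Fin.sum_univ_two]
  simp only [cornerUnit, ← sub_eq_add_neg]
  push_cast
  ring

/-- Planar lattice harmonicity in the two languages of the tree agrees. [folklore] -/
theorem isLatticeHarmonicOn_iff_isZdHarmonicOn (H : Site 2 → ℝ) (S : Set (Site 2)) :
    IsLatticeHarmonicOn H S ↔ IsZdHarmonicOn H S := by
  simp only [IsLatticeHarmonicOn, IsZdHarmonicOn, latticeLaplacian_eq_latticeLaplacianZd]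

/-- The planar Laplacian `latticeLaplacianZd` (`d = 2`) written out with its four neighbours.
[folklore] -/
theorem latticeLaplacianZd_two (H : Site 2 → ℝ) (v : Site 2) :
    latticeLaplacianZd H v = H (v + Pi.single 0 1) + H (v - Pi.single 0 1) +
      (H (v + Pi.single 1 1) + H (v - Pi.single 1 1)) - 4 * H v := by
  rw [latticeLaplacianZd_def, Fin.sum_univ_two]
  push_cast
  ring

/-- Coordinates of the four neighbours of a planar site. [folklore] -/
theorem neighbour_coords (v : Site 2) :
    ((v + Pi.single 0 1 : Site 2) 0 = v 0 + 1 ∧ (v + Pi.single 0 1 : Site 2) 1 = v 1) ∧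
    ((v - Pi.single 0 1 : Site 2) 0 = v 0 - 1 ∧ (v - Pi.single 0 1 : Site 2) 1 = v 1) ∧
    ((v + Pi.single 1 1 : Site 2) 0 = v 0 ∧ (v + Pi.single 1 1 : Site 2) 1 = v 1 + 1) ∧
    ((v - Pi.single 1 1 : Site 2) 0 = v 0 ∧ (v - Pi.single 1 1 : Site 2) 1 = v 1 - 1) := by
  simp

/-- The neighbours of `z` in `ℤ²` are the sites at `ℓ¹`-distance one (coordinate form).
[folklore] -/
theorem adj_iff_coords (z w : Site 2) : (zdGraph 2).Adj z w ↔
    (w 0 = z 0 + 1 ∧ w 1 = z 1) ∨ (w 0 = z 0 - 1 ∧ w 1 = z 1) ∨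
    (w 0 = z 0 ∧ w 1 = z 1 + 1) ∨ (w 0 = z 0 ∧ w 1 = z 1 - 1) := by
  refine ⟨WeakBeurling.coord_step_of_adj, fun h => ?_⟩
  rw [zdGraph_adj_iff]
  have hw : ∀ a b : ℤ, w 0 = a → w 1 = b → w = ![a, b] := fun a b ha hb => by
    funext i; fin_cases i
    · exact ha
    · exact hb
  rcases h with ⟨h0, h1⟩ | ⟨h0, h1⟩ | ⟨h0, h1⟩ | ⟨h0, h1⟩
  · refine ⟨0, Or.inl ?_⟩
    rw [hw _ _ h0 h1]; funext i; fin_cases i <;> simp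
  · refine ⟨0, Or.inr ?_⟩
    rw [hw _ _ h0 h1]; funext i; fin_cases i <;> simp
  · refine ⟨1, Or.inl ?_⟩
    rw [hw _ _ h0 h1]; funext i; fin_cases i <;> simp
  · refine ⟨1, Or.inr ?_⟩
    rw [hw _ _ h0 h1]; funext i; fin_cases i <;> simp

/-! ### Half-rectangles standing on a row (specification style) -/

/-- The explicit finite set `∏ᵢ [lowᵢ, highᵢ]` is the half-rectangle
`{v : y₀ - n ≤ v₀ ≤ y₀ + n, y₁ ≤ v₁ ≤ y₁ + T}`. [folklore] -/
theorem mem_piFinset_halfRect (y : Site 2) (n T : ℕ) (v : Site 2) :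
    v ∈ (Fintype.piFinset fun i =>
      Finset.Icc ((![y 0 - n, y 1] : Site 2) i) ((![y 0 + n, y 1 + T] : Site 2) i)) ↔
      (y 0 - n ≤ v 0 ∧ v 0 ≤ y 0 + n) ∧ (y 1 ≤ v 1 ∧ v 1 ≤ y 1 + T) := by
  simp [Fintype.mem_piFinset, Fin.forall_fin_two]

/-- Half-rectangles of every size exist as finite sets. [folklore] -/
theorem exists_halfRect (y : Site 2) (n T : ℕ) : ∃ Q : Finset (Site 2),
    ∀ v : Site 2, v ∈ Q ↔ (y 0 - n ≤ v 0 ∧ v 0 ≤ y 0 + n) ∧ (y 1 ≤ v 1 ∧ v 1 ≤ y 1 + T) :=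
  ⟨_, mem_piFinset_halfRect y n T⟩

section HalfRect

variable {Q : Finset (Site 2)} {y : Site 2} {n T : ℕ}
  (hQ : ∀ v : Site 2, v ∈ Q ↔ (y 0 - n ≤ v 0 ∧ v 0 ≤ y 0 + n) ∧ (y 1 ≤ v 1 ∧ v 1 ≤ y 1 + T))
include hQ

/-- The base point lies in its half-rectangle. [folklore] -/
theorem self_mem_halfRect : y ∈ Q := by
  rw [hQ]; omega

/-- **The outer boundary of a half-rectangle**: a bottom row `Y = -1`, a top row `Y = T+1` (both
with `|X| ≤ n`) and two sides `X = ±(n+1)`, `0 ≤ Y ≤ T` (`X = z₀ - y₀`, `Y = z₁ - y₁`).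
[folklore] -/
theorem outerBoundary_halfRect {z : Site 2} (hz : z ∈ outerBoundary (zdGraph 2) Q) :
    (z 1 = y 1 - 1 ∧ y 0 - n ≤ z 0 ∧ z 0 ≤ y 0 + n) ∨
    (z 1 = y 1 + T + 1 ∧ y 0 - n ≤ z 0 ∧ z 0 ≤ y 0 + n) ∨
    ((z 0 = y 0 - n - 1 ∨ z 0 = y 0 + n + 1) ∧ y 1 ≤ z 1 ∧ z 1 ≤ y 1 + T) := by
  rw [mem_outerBoundary_iff] at hz
  obtain ⟨hzQ, w, hw, hadj⟩ := hz
  rw [hQ] at hzQ hw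
  rcases (adj_iff_coords z w).1 hadj with h | h | h | h <;> omega

/-- A point of the outer boundary of a half-rectangle lies in the slab `-1 ≤ Y ≤ T+1`,
`|X| ≤ n+1`. [folklore] -/
theorem outerBoundary_halfRect_slab {z : Site 2} (hz : z ∈ outerBoundary (zdGraph 2) Q) :
    y 1 - 1 ≤ z 1 ∧ z 1 ≤ y 1 + T + 1 ∧ y 0 - n - 1 ≤ z 0 ∧ z 0 ≤ y 0 + n + 1 := by
  rcases outerBoundary_halfRect hQ hz with h | h | h <;> omega

end HalfRect

/-- The outer boundary of a finite set with one point `p` removed: the old outer boundary, or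
the point `p` itself. [folklore] -/
theorem outerBoundary_erase_subset {Q : Finset (Site 2)} {p z : Site 2}
    (hz : z ∈ outerBoundary (zdGraph 2) (Q.erase p)) :
    z = p ∨ z ∈ outerBoundary (zdGraph 2) Q := by
  rw [mem_outerBoundary_iff] at hz
  obtain ⟨hzQ, w, hw, hadj⟩ := hz
  by_cases hzp : z = p
  · exact Or.inl hzp
  · refine Or.inr (mem_outerBoundary_iff.2 ⟨fun h => hzQ (Finset.mem_erase.2 ⟨hzp, h⟩), w,
      (Finset.mem_erase.1 hw).2, hadj⟩)

/-! ### The quadratic side barrier -/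

section Barrier

variable {y : Site 2} {n : ℕ} {q : Site 2 → ℝ}
  (hq : ∀ v : Site 2, q v = (((v 1 - y 1 : ℤ) : ℝ) + 1) / ((n : ℝ) + 2) +
    (((v 0 - y 0 : ℤ) : ℝ) ^ 2 + (((v 1 - y 1 : ℤ) : ℝ) + 1) * ((n : ℝ) + 1 - ((v 1 - y 1 : ℤ) : ℝ))) /
      ((n : ℝ) + 1) ^ 2)
include hq

/-- **The side barrier `q(v) = (Y+1)/(n+2) + (X² + (Y+1)(n+1-Y))/(n+1)²` is discrete harmonic on
all of `ℤ²`** (`Δ X² = 2 = -Δ[(Y+1)(n+1-Y)]`, linear terms are harmonic). [folklore] -/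
theorem latticeLaplacianZd_sideBarrier (v : Site 2) : latticeLaplacianZd q v = 0 := by
  rw [latticeLaplacianZd_two]
  obtain ⟨⟨a0, a1⟩, ⟨b0, b1⟩, ⟨c0, c1⟩, ⟨d0, d1⟩⟩ := neighbour_coords v
  simp only [hq, a0, a1, b0, b1, c0, c1, d0, d1]
  have hn1 : ((n : ℝ) + 1) ≠ 0 := by positivity
  have hn2 : ((n : ℝ) + 2) ≠ 0 := by positivity
  push_cast
  field_simp
  ring

/-- `q ≥ 0` on the slab `-1 ≤ Y ≤ n+1`. [folklore] -/
theorem sideBarrier_nonneg {v : Site 2} (h1 : y 1 - 1 ≤ v 1) (h2 : v 1 ≤ y 1 + n + 1) :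
    0 ≤ q v := by
  rw [hq]
  have hY0 : (0 : ℝ) ≤ ((v 1 - y 1 : ℤ) : ℝ) + 1 := by
    have : (0 : ℤ) ≤ v 1 - y 1 + 1 := by omega
    exact_mod_cast this
  have hY1 : (0 : ℝ) ≤ (n : ℝ) + 1 - ((v 1 - y 1 : ℤ) : ℝ) := by
    have : (v 1 - y 1 : ℤ) ≤ (n : ℤ) + 1 := by omega
    have h' : ((v 1 - y 1 : ℤ) : ℝ) ≤ (n : ℝ) + 1 := by exact_mod_cast this
    linarith
  positivity

/-- `q ≥ 1` on the top row `Y = n+1`. [folklore] -/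
theorem one_le_sideBarrier_top {v : Site 2} (h : v 1 = y 1 + n + 1) : 1 ≤ q v := by
  rw [hq]
  have hY : ((v 1 - y 1 : ℤ) : ℝ) = (n : ℝ) + 1 := by
    have : (v 1 - y 1 : ℤ) = (n : ℤ) + 1 := by omega
    rw [this]; push_cast; ring
  rw [hY]
  have hn2 : (0 : ℝ) < (n : ℝ) + 2 := by positivity
  have e1 : ((n : ℝ) + 1 + 1) / ((n : ℝ) + 2) = 1 := by
    rw [div_eq_one_iff_eq hn2.ne']; ring
  rw [e1]
  have : 0 ≤ (((v 0 - y 0 : ℤ) : ℝ) ^ 2 + ((n : ℝ) + 1 + 1) * ((n : ℝ) + 1 - ((n : ℝ) + 1))) /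
      ((n : ℝ) + 1) ^ 2 := by
    apply div_nonneg _ (by positivity)
    nlinarith [sq_nonneg (((v 0 - y 0 : ℤ) : ℝ))]
  linarith

/-- `q ≥ 1` on the sides `|X| ≥ n+1` of the slab `-1 ≤ Y ≤ n+1`. [folklore] -/
theorem one_le_sideBarrier_side {v : Site 2} (h1 : y 1 - 1 ≤ v 1) (h2 : v 1 ≤ y 1 + n + 1)
    (hX : (n : ℤ) + 1 ≤ |v 0 - y 0|) : 1 ≤ q v := by
  rw [hq]
  have hY0 : (0 : ℝ) ≤ ((v 1 - y 1 : ℤ) : ℝ) + 1 := by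
    have : (0 : ℤ) ≤ v 1 - y 1 + 1 := by omega
    exact_mod_cast this
  have hY1 : (0 : ℝ) ≤ (n : ℝ) + 1 - ((v 1 - y 1 : ℤ) : ℝ) := by
    have : (v 1 - y 1 : ℤ) ≤ (n : ℤ) + 1 := by omega
    have h' : ((v 1 - y 1 : ℤ) : ℝ) ≤ (n : ℝ) + 1 := by exact_mod_cast this
    linarith
  have hXsq : ((n : ℝ) + 1) ^ 2 ≤ ((v 0 - y 0 : ℤ) : ℝ) ^ 2 := by
    have habs : ((n : ℝ) + 1) ≤ |((v 0 - y 0 : ℤ) : ℝ)| := by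
      rw [← Int.cast_abs]; exact_mod_cast hX
    calc ((n : ℝ) + 1) ^ 2 ≤ |((v 0 - y 0 : ℤ) : ℝ)| ^ 2 := by gcongr
      _ = ((v 0 - y 0 : ℤ) : ℝ) ^ 2 := sq_abs _
  have hpos : (0 : ℝ) < ((n : ℝ) + 1) ^ 2 := by positivity
  have hsecond : 1 ≤ (((v 0 - y 0 : ℤ) : ℝ) ^ 2 +
      (((v 1 - y 1 : ℤ) : ℝ) + 1) * ((n : ℝ) + 1 - ((v 1 - y 1 : ℤ) : ℝ))) / ((n : ℝ) + 1) ^ 2 := by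
    rw [le_div_iff₀ hpos]
    nlinarith [mul_nonneg hY0 hY1]
  have hfirst : 0 ≤ (((v 1 - y 1 : ℤ) : ℝ) + 1) / ((n : ℝ) + 2) := by positivity
  linarith

/-- `q ≥ 1` on the far part (top row and sides) of the outer boundary of the half-box of size
`n` at `y`. [folklore] -/
theorem one_le_sideBarrier_far {Q : Finset (Site 2)}
    (hQ : ∀ v : Site 2, v ∈ Q ↔ (y 0 - n ≤ v 0 ∧ v 0 ≤ y 0 + n) ∧ (y 1 ≤ v 1 ∧ v 1 ≤ y 1 + n))
    {z : Site 2} (hz : z ∈ outerBoundary (zdGraph 2) Q) (hfar : y 1 ≤ z 1) : 1 ≤ q z := by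
  rcases outerBoundary_halfRect hQ hz with h | h | h
  · omega
  · exact one_le_sideBarrier_top hq (by omega)
  · refine one_le_sideBarrier_side hq (by omega) (by omega) ?_
    rcases h.1 with h0 | h0
    · rw [h0, show y 0 - ↑n - 1 - y 0 = -((n : ℤ) + 1) by ring, abs_neg,
        abs_of_nonneg (by positivity)]
    · rw [h0, show y 0 + ↑n + 1 - y 0 = (n : ℤ) + 1 by ring, abs_of_nonneg (by positivity)]

/-- At the centre, `q(y) = 1/(n+2) + 1/(n+1) ≤ 2/(n+1)`. [folklore] -/
theorem sideBarrier_self_le : q y ≤ 2 / ((n : ℝ) + 1) := by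
  rw [hq]
  simp only [sub_self, Int.cast_zero, zero_add, one_mul, sub_zero]
  have hn1 : (0 : ℝ) < (n : ℝ) + 1 := by positivity
  have hn2 : (0 : ℝ) < (n : ℝ) + 2 := by positivity
  have e1 : ((0 : ℝ) ^ 2 + ((n : ℝ) + 1)) / ((n : ℝ) + 1) ^ 2 = 1 / ((n : ℝ) + 1) := by
    field_simp; ring
  rw [e1]
  have h1 : 1 / ((n : ℝ) + 2) ≤ 1 / ((n : ℝ) + 1) :=
    one_div_le_one_div_of_le hn1 (by linarith)
  have e2 : 2 / ((n : ℝ) + 1) = 1 / ((n : ℝ) + 1) + 1 / ((n : ℝ) + 1) := by ring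
  linarith

/-- **`q ≤ 1/2` on the inner half-box** of size `k` when `8k ≤ n` and `k ≥ 1`:
`(Y+1)/(n+2) ≤ (k+1)/(8k+2) ≤ 1/5`, `X²/(n+1)² ≤ 1/64`, `(Y+1)(n+1-Y)/(n+1)² ≤ (k+1)/(8k+1) ≤ 2/9`.
[folklore] -/
theorem sideBarrier_le_half {k : ℕ} (hk : 1 ≤ k) (hkn : 8 * k ≤ n) {v : Site 2}
    (hv0 : y 0 - k ≤ v 0 ∧ v 0 ≤ y 0 + k) (hv1 : y 1 ≤ v 1 ∧ v 1 ≤ y 1 + k) : q v ≤ 1 / 2 := by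
  rw [hq]
  set X : ℝ := ((v 0 - y 0 : ℤ) : ℝ) with hXdef
  set Y : ℝ := ((v 1 - y 1 : ℤ) : ℝ) with hYdef
  have hkr : (1 : ℝ) ≤ k := by exact_mod_cast hk
  have hknr : 8 * (k : ℝ) ≤ n := by exact_mod_cast hkn
  have hY0 : 0 ≤ Y := by
    have : (0 : ℤ) ≤ v 1 - y 1 := by omega
    rw [hYdef]; exact_mod_cast this
  have hYk : Y ≤ k := by
    have : v 1 - y 1 ≤ (k : ℤ) := by omega
    rw [hYdef]; exact_mod_cast this
  have hXk : X ^ 2 ≤ (k : ℝ) ^ 2 := by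
    have habs : |X| ≤ k := by
      have : |v 0 - y 0| ≤ (k : ℤ) := by rw [abs_le]; omega
      rw [hXdef, ← Int.cast_abs]; exact_mod_cast this
    calc X ^ 2 = |X| ^ 2 := (sq_abs X).symm
      _ ≤ (k : ℝ) ^ 2 := by gcongr
  have hn2 : (0 : ℝ) < (n : ℝ) + 2 := by positivity
  have h1 : (Y + 1) / ((n : ℝ) + 2) ≤ 1 / 5 := by
    rw [div_le_div_iff₀ hn2 (by norm_num)]
    nlinarith
  have h2 : (X ^ 2 + (Y + 1) * ((n : ℝ) + 1 - Y)) / ((n : ℝ) + 1) ^ 2 ≤ 1 / 64 + 2 / 9 := by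
    rw [div_le_iff₀ (by positivity)]
    have hA : X ^ 2 ≤ 1 / 64 * ((n : ℝ) + 1) ^ 2 := by nlinarith
    have hB : (Y + 1) * ((n : ℝ) + 1 - Y) ≤ 2 / 9 * ((n : ℝ) + 1) ^ 2 := by
      have hB1 : (Y + 1) * ((n : ℝ) + 1 - Y) ≤ ((k : ℝ) + 1) * ((n : ℝ) + 1) := by nlinarith
      have hB2 : ((k : ℝ) + 1) * ((n : ℝ) + 1) ≤ 2 / 9 * ((n : ℝ) + 1) ^ 2 := by nlinarith
      linarith
    linarith
  linarith

end Barrier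

/-! ### (A) The harmonic measure of the far sides -/

/-- **Escape through the far sides, general form.** Let `Q` be the half-box of size `n` at `y`,
`Λ ⊆ Q` obtained by removing at most one point `p` (`Λ = Q` or `Λ = Q ∖ {p}`), and `w ∈ Λ`.
Then the harmonic measure from `w` in `Λ` of the far part (top row and sides) of `∂Q` is at most
the side barrier `q(w)`: Green's representation of the harmonic `q ≥ 0` (on `∂Λ`), `q ≥ 1` on the
far part. [folklore] -/
theorem sum_poissonKernel_far_le_of {Q Λ : Finset (Site 2)} {y : Site 2} {n : ℕ}
    (hQ : ∀ v : Site 2, v ∈ Q ↔ (y 0 - n ≤ v 0 ∧ v 0 ≤ y 0 + n) ∧ (y 1 ≤ v 1 ∧ v 1 ≤ y 1 + n))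
    {q : Site 2 → ℝ}
    (hq : ∀ v : Site 2, q v = (((v 1 - y 1 : ℤ) : ℝ) + 1) / ((n : ℝ) + 2) +
      (((v 0 - y 0 : ℤ) : ℝ) ^ 2 + (((v 1 - y 1 : ℤ) : ℝ) + 1) * ((n : ℝ) + 1 - ((v 1 - y 1 : ℤ) : ℝ))) /
        ((n : ℝ) + 1) ^ 2)
    (hΛQ : Λ ⊆ Q) (hΛ : ∀ z ∈ outerBoundary (zdGraph 2) Λ, z ∈ Q ∨ z ∈ outerBoundary (zdGraph 2) Q)
    {w : Site 2} (hw : w ∈ Λ) :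
    ∑ z ∈ (outerBoundary (zdGraph 2) Q).filter (fun z => y 1 ≤ z 1), poissonKernel Λ w z ≤ q w := by
  have hd : 0 < 2 := by norm_num
  have hrep := green_representation hd Λ q hw
  have hvol : ∑ v ∈ Λ, dirichletGreen Λ w v * (-latticeLaplacianZd q v) = 0 :=
    Finset.sum_eq_zero fun v _ => by rw [latticeLaplacianZd_sideBarrier hq, neg_zero, mul_zero]
  rw [hvol, zero_add] at hrep
  -- `q ≥ 0` on `∂Λ ⊆ Q ∪ ∂Q` (both inside the slab)
  have hslab : ∀ z ∈ outerBoundary (zdGraph 2) Λ, 0 ≤ q z := fun z hz => by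
    rcases hΛ z hz with h | h
    · rw [hQ] at h
      exact sideBarrier_nonneg hq (by omega) (by omega)
    · have h' := outerBoundary_halfRect_slab hQ h
      exact sideBarrier_nonneg hq h'.1 h'.2.1
  -- far points of `∂Q` outside `∂Λ` carry no harmonic measure
  have hzero : ∀ z ∈ (outerBoundary (zdGraph 2) Q).filter (fun z => y 1 ≤ z 1),
      z ∉ outerBoundary (zdGraph 2) Λ → poissonKernel Λ w z * q z = 0 := by
    intro z hz hzΛ
    rw [Finset.mem_filter, mem_outerBoundary_iff] at hz
    have hzΛ' : z ∉ Λ := fun h => hz.1.1 (hΛQ h)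
    rw [poissonKernel, if_neg hzΛ', Finset.sum_eq_zero, zero_mul]
    intro v hv
    by_cases hvΛ : v ∈ Λ
    · exact absurd (mem_outerBoundary_iff.2 ⟨hzΛ', v, hvΛ, (SimpleGraph.mem_neighborFinset _ _ _).1 hv⟩) hzΛ
    · exact dirichletGreen_of_not_mem_right Λ w hvΛ
  calc ∑ z ∈ (outerBoundary (zdGraph 2) Q).filter (fun z => y 1 ≤ z 1), poissonKernel Λ w z
      ≤ ∑ z ∈ (outerBoundary (zdGraph 2) Q).filter (fun z => y 1 ≤ z 1),
          poissonKernel Λ w z * q z := by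
        refine Finset.sum_le_sum fun z hz => ?_
        have hH := poissonKernel_nonneg hd Λ w z
        have hq1 : 1 ≤ q z := by
          rw [Finset.mem_filter] at hz
          exact one_le_sideBarrier_far hq hQ hz.1 hz.2
        nlinarith
    _ = ∑ z ∈ ((outerBoundary (zdGraph 2) Q).filter (fun z => y 1 ≤ z 1)).filter
          (fun z => z ∈ outerBoundary (zdGraph 2) Λ), poissonKernel Λ w z * q z := by
        symm
        refine Finset.sum_filter_of_ne fun z hz hne => ?_
        by_contra hzΛ
        exact hne (hzero z hz hzΛ)
    _ ≤ ∑ z ∈ outerBoundary (zdGraph 2) Λ, poissonKernel Λ w z * q z := by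
        refine Finset.sum_le_sum_of_subset_of_nonneg (fun z hz => (Finset.mem_filter.1 hz).2)
          fun z hz _ => mul_nonneg (poissonKernel_nonneg hd Λ w z) (hslab z hz)
    _ = q w := hrep.symm

/-- **(A) Escape through the far sides costs `O(1/n)`.** For the half-box `Q` of size `n`
standing on the row of `y`, the harmonic measure from `y` of the part of `∂Q` off the bottom
row (top row and two sides) is at most `q(y) ≤ 2/(n+1)`. [folklore] -/
theorem sum_poissonKernel_far_le {Q : Finset (Site 2)} {y : Site 2} {n : ℕ}
    (hQ : ∀ v : Site 2, v ∈ Q ↔ (y 0 - n ≤ v 0 ∧ v 0 ≤ y 0 + n) ∧ (y 1 ≤ v 1 ∧ v 1 ≤ y 1 + n)) :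
    ∑ z ∈ (outerBoundary (zdGraph 2) Q).filter (fun z => y 1 ≤ z 1),
      poissonKernel Q y z ≤ 2 / ((n : ℝ) + 1) := by
  set q : Site 2 → ℝ := fun v => (((v 1 - y 1 : ℤ) : ℝ) + 1) / ((n : ℝ) + 2) +
    (((v 0 - y 0 : ℤ) : ℝ) ^ 2 + (((v 1 - y 1 : ℤ) : ℝ) + 1) * ((n : ℝ) + 1 - ((v 1 - y 1 : ℤ) : ℝ))) /
      ((n : ℝ) + 1) ^ 2 with hqdef
  have hq : ∀ v : Site 2, q v = (((v 1 - y 1 : ℤ) : ℝ) + 1) / ((n : ℝ) + 2) +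
    (((v 0 - y 0 : ℤ) : ℝ) ^ 2 + (((v 1 - y 1 : ℤ) : ℝ) + 1) * ((n : ℝ) + 1 - ((v 1 - y 1 : ℤ) : ℝ))) /
      ((n : ℝ) + 1) ^ 2 := fun v => rfl
  calc ∑ z ∈ (outerBoundary (zdGraph 2) Q).filter (fun z => y 1 ≤ z 1), poissonKernel Q y z
      ≤ q y := sum_poissonKernel_far_le_of hQ hq subset_rfl (fun z hz => Or.inr hz)
          (self_mem_halfRect hQ)
    _ ≤ 2 / ((n : ℝ) + 1) := sideBarrier_self_le hq

/-! ### Registered sub-goal of the stub carried by this file -/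

/-- **Sub-goal `s10_farSidesHarmonicMeasure`** (registered on stmt-CriticalPhenomena-14132; step
(A) of the Green-locality half G1 of `stub_clusterLocalityV2`): from the centre of the bottom
row of the lattice half-box `{|v₀ - y₀| ≤ n, y₁ ≤ v₁ ≤ y₁ + n}`, the harmonic measure of the
part of its outer boundary off the absorbing bottom row is at most `2/(n+1)`
(`sum_poissonKernel_far_le`). [folklore] -/
theorem s10_farSidesHarmonicMeasure : ∀ (y : Literature.Probability.LatticeModels.Site 2) (n : ℕ), ∑ z ∈ (Literature.Probability.LatticeModels.outerBoundary (Literature.Probability.LatticeModels.zdGraph 2) (Fintype.piFinset fun i => Finset.Icc ((![y 0 - n, y 1] : Literature.Probability.LatticeModels.Site 2) i) ((![y 0 + n, y 1 + n] : Literature.Probability.LatticeModels.Site 2) i))).filter (fun z => y 1 ≤ z 1), Literature.Probability.LatticeModels.poissonKernel (Fintype.piFinset fun i => Finset.Icc ((![y 0 - n, y 1] : Literature.Probability.LatticeModels.Site 2) i) ((![y 0 + n, y 1 + n] : Literature.Probability.LatticeModels.Site 2) i)) y z ≤ 2 / ((n : ℝ) + 1) :=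
  fun y n => sum_poissonKernel_far_le (mem_piFinset_halfRect y n n)

end Summit.CriticalPhenomena.CardyFormulaZ2.Cruxes.BoundaryDefectGaussianR.RainbowMonomialsInExcursionKernels

end
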